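import Mathlib.LinearAlgebra.QuadraticForm.IsometryEquiv
import Mathlib.RingTheory.Trace.Basic
import Mathlib.NumberTheory.NumberField.InfinitePlace.TotallyRealComplex
import HarnessLib

/-!
# The transfer `T_E(W)` of a quadratic form over a number field; E-structures on rational forms of signature `(3, 2m - 3)` (Bayer-Fluckiger–van Geemen–Schütt 2025)

Topic `Literature/NumberTheory/QuadraticForms`; `cite` item wi-11399 (route
HodgeConjecture/EvenB2Twistor: support item `LatticeEStructure`, crux `HyperholomorphicTransport`).

Source read (E. Bayer-Fluckiger, B. van Geemen, M. Schütt, *Non-projective K3 surfaces with real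
or Salem multiplication*, arXiv:2511.19970, 2025; `lit read arxiv:2511.19970`, §3 and §11):

* §3, Def. 3.2: "Let `W` be a finite dimensional `E`-vector space, and let `Q : W × W → E` be a
  quadratic form [...]. We denote by `T_E(W) = (W, q)` the quadratic form over `ℚ` defined by
  `q(x, y) = Tr_{E/ℚ}(Q(x, y))`, called the transfer of `W`." (§3: "A quadratic form over `k` is by
  definition a pair `V = (V, q)` [...] `q` a non-degenerate symmetric bilinear form"; "Every
  [quadratic] form over `E` can be diagonalized, `(W, h) ≃ ⟨α₁, …, αₙ⟩`".)
* Lemma 3.1 (= [BGS] Lemma 5.1): an `E`-module structure on a quadratic form `(U, q)` over `ℚ`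
  satisfies the ADJOINT CONDITION `q(α x, y) = q(x, α y)` (trivial involution) iff
  `q = Tr_{E/ℚ} ∘ h` for a quadratic form `h` over `E`; the easy direction is `polar_transfer_smul`.
* Cor. 11.4: "Let `E` be a real quadratic field, and let `U` be a quadratic form over `ℚ` of
  dimension `2m` with `m` odd and signature `(3, 2m - 3)`; suppose that `U` has determinant `-1`.
  Fix `r₀ ∈ {2, 3}`. Then there exists a quadratic form `W` over `E` such that `U ≃ T(W)` and that
  there is an embedding `σ : E → ℝ` with `W_σ` of signature `(r₀, m - r₀)`." followed by:
  "Applied to `U = V_{K3}`, this provides a new proof of Proposition (md=22)." (`V_{K3} =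
  Λ_{K3} ⊗ ℚ`, `Λ_{K3} = H^{⊕3} ⊕ E₈(-1)^{⊕2}` of signature `(3, 19)`, §2.1; `m = 11`.)

## Content

* `transfer E Q` — the transfer `T_E(W)`: Mathlib's `(Algebra.trace ℚ E).compQuadraticMap' Q`, a
  `QuadraticForm ℚ W` on the underlying `ℚ`-space of the `E`-space `W`; `transfer_apply`,
  `polar_transfer`, and the adjoint condition `polar_transfer_smul` (Lemma 3.1, (ii) ⇒ (i), proved).
* `HasSignature Q r s` — a quadratic form over an ordered field is equivalent to a diagonal form
  `⟨w⟩` with `r` positive and `s` negative weights (over `ℝ`, or for a `ℚ`-form after base change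
  to `ℝ`, this is "signature `(r, s)`" by Sylvester's law of inertia; stated over the ordered
  ground field itself so that no base change is needed: a rational form diagonalises over `ℚ`).
  `hasSignature_weightedSumSquares` (proved).
* The NAMED FACT `BFvGS2025_transfer_realQuadratic_of_det_neg_one` (Cor. 11.4), statement only.
  Rendering: `E` a real quadratic field = a totally real number field of degree `2`
  (`NumberField.IsTotallyReal`, `Module.finrank ℚ E = 2`); `U` is GIVEN diagonalised,
  `U ≃ ⟨c⟩` with `3` positive and `2m - 3` negative rational weights (signature `(3, 2m - 3)`,
  dimension `2m`) and `-∏ cᵢ` a square (determinant `-1` in `ℚˣ/ℚˣ²`); the conclusion produces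
  `W = ⟨α₁, …, α_m⟩` DIAGONAL over `E` (every form diagonalises, §3) with all `αᵢ ≠ 0`
  (non-degenerate), an isometry `U ≃ T_E(W)`, and an embedding `σ : E →+* ℝ` under which exactly
  `r₀` of the `αᵢ` are positive — i.e. `W_σ = ⟨σ α₁, …, σ α_m⟩_ℝ` has signature `(r₀, m - r₀)`.
  The printed hypothesis "`m` odd" is kept; `3 ≤ m` is implicit in "signature `(3, 2m - 3)`" and
  made explicit.

NOT here (no vocabulary in the tree, or not requested): Thm. 11.2 / Cor. 11.3 / Cor. 11.5 (the
`iff` versions with the norm condition `det U = N_{E/ℚ}(α) Δ_E^m`); the explicit K3 witness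
(`m = 11`, `U = ⟨1, 1, 1, -1, …, -1⟩`: `W = ⟨√d, √d, ±√d, -1/2, …, -1/2⟩`, `T⟨±√d⟩ ≅ ⟨1, -1⟩`,
`T⟨-1/2⟩ = ⟨-1, -d⟩`, `⟨d⟩^4 ≅ ⟨1⟩^4` by four squares — a proof of the K3 case, left to the
route's support item, which states it in `22 × 22` matrix form); the Hodge-theoretic half of the
paper (pseudo-polarized Hodge structures of K3 type, Def. 2.5, and Thm. 7.1) is vendored
separately under `Literature/AlgebraicGeometry/Motives/`; Thm. 1.3 (K3 surfaces of algebraic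
dimension `0` realising the family) needs compact complex surfaces and is cite-only.

## References

* [BayerFluckigerVanGeemenSchuett2025] E. Bayer-Fluckiger, B. van Geemen, M. Schütt,
  *Non-projective K3 surfaces with real or Salem multiplication*, arXiv:2511.19970 (2025),
  Def. 3.2, Lemma 3.1, Lemma 3.4, Thm. 11.2, Cor. 11.3, Cor. 11.4. Read pp. 8, 19–20 of the
  materialised text.
* [BayerFluckigerVanGeemenSchuett2024] (= [BGS] in the source) E. Bayer-Fluckiger, B. van Geemen,
  M. Schütt, *K3 surfaces with real or complex multiplication*, arXiv:2401.04072, Lemma 5.1,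
  Lemma 6.1, Thm. 9.3 (cited through the above, not re-read).
-/

namespace Literature.NumberTheory.QuadraticForms

open QuadraticMap

universe u v

/-! ### The transfer of a quadratic form -/

section transfer

variable (E : Type*) [Field E] [Algebra ℚ E] {W : Type*} [AddCommGroup W] [Module E W]
  [Module ℚ W] [IsScalarTower ℚ E W]

/-- The **transfer** `T_E(W)` of a quadratic form `Q` on an `E`-vector space `W`, `E` a number
field (more generally a `ℚ`-algebra with a trace): the rational quadratic form
`x ↦ Tr_{E/ℚ}(Q(x))` on the underlying `ℚ`-vector space of `W` (so `dim_ℚ T_E(W) =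
[E : ℚ] · dim_E W`, Lemma 3.4 (i)). Mathlib's `LinearMap.compQuadraticMap'` with the trace
`Algebra.trace ℚ E : E →ₗ[ℚ] ℚ`. [cite: BayerFluckigerVanGeemenSchuett2025, Def. 3.2] -/
noncomputable def transfer (Q : QuadraticForm E W) : QuadraticForm ℚ W :=
  (Algebra.trace ℚ E).compQuadraticMap' Q

/-- `T_E(W)(x) = Tr_{E/ℚ}(Q(x))`. [cite: BayerFluckigerVanGeemenSchuett2025, Def. 3.2] -/
@[simp]
theorem transfer_apply (Q : QuadraticForm E W) (x : W) :
    transfer E Q x = Algebra.trace ℚ E (Q x) :=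
  rfl

/-- The bilinear form of the transfer is the trace of the bilinear form:
`q(x, y) = Tr_{E/ℚ}(Q(x, y))` (on polar forms, `polar Q x y = Q(x + y) - Q x - Q y = 2 Q(x, y)`).
[cite: BayerFluckigerVanGeemenSchuett2025, Def. 3.2] -/
theorem polar_transfer (Q : QuadraticForm E W) (x y : W) :
    polar (transfer E Q) x y = Algebra.trace ℚ E (polar Q x y) :=
  LinearMap.compQuadraticMap_polar _ Q x y

/-- **The adjoint condition** (Lemma 3.1, direction (ii) ⇒ (i), trivial involution): the
`E`-action on `T_E(W)` is self-adjoint, `q(α x, y) = q(x, α y)` for all `α ∈ E`.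
[cite: BayerFluckigerVanGeemenSchuett2025, Lemma 3.1] -/
theorem polar_transfer_smul (Q : QuadraticForm E W) (a : E) (x y : W) :
    polar (transfer E Q) (a • x) y = polar (transfer E Q) x (a • y) := by
  rw [polar_transfer, polar_transfer, polar_smul_left, polar_smul_right]

/-- `q(α x, y) = Tr_{E/ℚ}(α · Q(x, y))`. [cite: BayerFluckigerVanGeemenSchuett2025, Lemma 3.1] -/
theorem polar_transfer_smul_left (Q : QuadraticForm E W) (a : E) (x y : W) :
    polar (transfer E Q) (a • x) y = Algebra.trace ℚ E (a * polar Q x y) := by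
  rw [polar_transfer, polar_smul_left, smul_eq_mul]

end transfer

/-! ### Signatures over an ordered field -/

section signature

variable {K : Type*} [Field K] [LinearOrder K] {V : Type*} [AddCommGroup V] [Module K V]

/-- A quadratic form `Q` over an ordered field `K` **has signature `(r, s)`** if it is equivalent
to a diagonal form `⟨w⟩ = ∑ wᵢ xᵢ²` on `K^{r + s}` with `r` positive and `s` negative weights (in
particular `Q` is non-degenerate of rank `r + s`). For `K = ℝ` this is the signature in the
sense of Sylvester's law of inertia (rescale to weights `±1`); for `K = ℚ` it says that the real
form `Q_ℝ` has signature `(r, s)` (a rational form diagonalises over `ℚ`,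
`QuadraticForm.equivalent_weightedSumSquares`), which is how "signature" of a form over `ℚ`, or of
`W_σ` for a form `W = ⟨α⟩` over a number field under a real embedding `σ`, is meant in the source
(§3, §10–11). Well-definedness of `(r, s)` (inertia) is not needed to STATE results and is not
proved here. [cite: BayerFluckigerVanGeemenSchuett2025, §3 (signatures of `U` and of `W_σ`)] -/
def HasSignature (Q : QuadraticForm K V) (r s : ℕ) : Prop :=
  ∃ w : Fin r ⊕ Fin s → K, (∀ i, 0 < w (Sum.inl i)) ∧ (∀ j, w (Sum.inr j) < 0) ∧
    QuadraticMap.Equivalent Q (weightedSumSquares K w)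

/-- A diagonal form with `r` positive and `s` negative weights has signature `(r, s)`.
[folklore] -/
theorem hasSignature_weightedSumSquares {r s : ℕ} (w : Fin r ⊕ Fin s → K)
    (hpos : ∀ i, 0 < w (Sum.inl i)) (hneg : ∀ j, w (Sum.inr j) < 0) :
    HasSignature (weightedSumSquares K w) r s :=
  ⟨w, hpos, hneg, ⟨QuadraticMap.IsometryEquiv.refl _⟩⟩

/-- Signature is invariant under equivalence of forms. [folklore] -/
theorem HasSignature.of_equivalent {V' : Type*} [AddCommGroup V'] [Module K V']
    {Q : QuadraticForm K V} {Q' : QuadraticForm K V'} {r s : ℕ} (h : HasSignature Q r s)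
    (e : QuadraticMap.Equivalent Q' Q) : HasSignature Q' r s := by
  obtain ⟨w, hpos, hneg, hQ⟩ := h
  exact ⟨w, hpos, hneg, e.trans hQ⟩

end signature

/-! ### E-structures on rational forms of signature `(3, 2m - 3)` and determinant `-1` -/

/-- **Bayer-Fluckiger–van Geemen–Schütt 2025, Cor. 11.4** (NAMED FACT, statement only). "Let `E`
be a real quadratic field, and let `U` be a quadratic form over `ℚ` of dimension `2m` with `m` odd
and signature `(3, 2m - 3)`; suppose that `U` has determinant `-1`. Fix `r₀ ∈ {2, 3}`. Then there
exists a quadratic form `W` over `E` such that `U ≃ T(W)` and that there is an embedding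
`σ : E → ℝ` with `W_σ` of signature `(r₀, m - r₀)`." Rendering (module docstring): `E` is a
totally real number field of degree `2`; `U ≃ ⟨c⟩` over `ℚ` with `3` positive and `2m - 3`
negative weights `cᵢ` and `-∏ᵢ cᵢ` a square (determinant `-1 ∈ ℚˣ/ℚˣ²`); conclusion: nonzero
`α₁, …, α_m ∈ E` with `U ≃ T_E(⟨α₁, …, α_m⟩)` (`transfer` of the diagonal form on `E^m`) and a
real embedding `σ` making exactly `r₀` of the `αᵢ` positive (`W_σ ≅ ⟨σ αᵢ⟩_ℝ` has signature
`(r₀, m - r₀)`). `3 ≤ m` is implicit in the printed signature hypothesis. Proof in the source: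
Thm. 11.2 (Witt-group transfer results of [BGS]) via Cor. 11.3, using `det U = -1 =
-N_{E/ℚ}(1)`. For `U = V_{K3} = Λ_{K3} ⊗ ℚ` (`m = 11`, signature `(3, 19)`, determinant `-1`)
this is the E-structure on the rational K3 form used by route HodgeConjecture/EvenB2Twistor.
[cite: BayerFluckigerVanGeemenSchuett2025, Cor. 11.4] -/
def BFvGS2025_transfer_realQuadratic_of_det_neg_one : Prop :=
  ∀ ⦃E : Type u⦄ [Field E] [NumberField E] [NumberField.IsTotallyReal E],
    Module.finrank ℚ E = 2 →
  ∀ ⦃m : ℕ⦄, Odd m → 3 ≤ m → ∀ ⦃r₀ : ℕ⦄, r₀ = 2 ∨ r₀ = 3 →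
  ∀ ⦃V : Type v⦄ [AddCommGroup V] [Module ℚ V] (U : QuadraticForm ℚ V)
    (c : Fin 3 ⊕ Fin (2 * m - 3) → ℚ),
    (∀ i, 0 < c (Sum.inl i)) → (∀ j, c (Sum.inr j) < 0) →
    QuadraticMap.Equivalent U (weightedSumSquares ℚ c) → IsSquare (-∏ i, c i) →
    ∃ (α : Fin m → E) (σ : E →+* ℝ), (∀ i, α i ≠ 0) ∧
      (Finset.univ.filter fun i => 0 < σ (α i)).card = r₀ ∧
      QuadraticMap.Equivalent U (transfer E (weightedSumSquares E α))

/-- Unfolding of the hypothesis shape: under the fact, the signature-`(3, 2m-3)`,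
determinant-`-1` rational DIAGONAL form `⟨c⟩` itself is a transfer from every real quadratic
field, with prescribed `σ`-signature `(r₀, m - r₀)`. [cite: BayerFluckigerVanGeemenSchuett2025,
Cor. 11.4] -/
theorem BFvGS2025_transfer_realQuadratic_of_det_neg_one.diagonal
    (h : BFvGS2025_transfer_realQuadratic_of_det_neg_one.{u, 0})
    {E : Type u} [Field E] [NumberField E] [NumberField.IsTotallyReal E]
    (hE : Module.finrank ℚ E = 2) {m : ℕ} (hm : Odd m) (h3 : 3 ≤ m) {r₀ : ℕ}
    (hr : r₀ = 2 ∨ r₀ = 3) (c : Fin 3 ⊕ Fin (2 * m - 3) → ℚ)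
    (hpos : ∀ i, 0 < c (Sum.inl i)) (hneg : ∀ j, c (Sum.inr j) < 0) (hdet : IsSquare (-∏ i, c i)) :
    ∃ (α : Fin m → E) (σ : E →+* ℝ), (∀ i, α i ≠ 0) ∧
      (Finset.univ.filter fun i => 0 < σ (α i)).card = r₀ ∧
      QuadraticMap.Equivalent (weightedSumSquares ℚ c) (transfer E (weightedSumSquares E α)) :=
  h hE hm h3 hr (weightedSumSquares ℚ c) c hpos hneg ⟨QuadraticMap.IsometryEquiv.refl _⟩ hdet

end Literature.NumberTheory.QuadraticForms
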